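import Literature.AlgebraicGeometry.HodgeTheory.BlochEsnaultKerzFormalLifting
import HarnessLib

/-!
# Morrow 2014, Thm. 1.1: formal lifting of INTEGRAL `K₀`-classes along `Y ↪ Y_r` over `A = K⟦t⟧`,
# `K` algebraic over `ℚ` (the deformational part of Grothendieck's variational Hodge conjecture)

Literature topic `AlgebraicGeometry/HodgeTheory`; cite item wi-86135 (family hodge; consumer: route
`HodgeConjecture/FirstOrderSemiregularSeeds`, crux X2‴ = stmt-HodgeConjecture-24864, skeleton
`Cruxes/FirstOrderWeilSeedsEight/Lines/birthK.lean`, stub `stub_firstOrderKLift_abelian` — its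
one-parameter case). The item asked for two printed results "next to" the `p`-adic
`Crystalline/BlochEsnaultKerzLifting.lean`, in its `KZeroRat` / `ContinuousKZeroRat` currency:

1. Bloch–Esnault–Kerz 2014 (characteristic zero), Thm. 2 with Rem. 1 (arXiv numbering; Thm. 1.2 /
   Rem. 1.1 of the journal version) — ALREADY in the tree, as the named fact
   `Literature.AlgebraicGeometry.HodgeTheory.BlochEsnaultKerzFormalLifting` of the sibling file
   `HodgeTheory/BlochEsnaultKerzFormalLifting.lean` (disc-model vocabulary `DiscScheme.*`,
   `IsSmoothProjectiveDiscModel`, the hypothesis structure `DeRhamDiscRealization k`, condition (i)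
   `DeRhamDiscRealization.HodgeConditionKZeroRat`, clause (ii)
   `DeRhamDiscRealization.FormalVariationalHodgeAlongArc`). It is imported and reused here, never
   restated.
2. M. Morrow, *A case of the deformational Hodge conjecture via a pro Hochschild–Kostant–Rosenberg
   theorem*, C. R. Math. Acad. Sci. Paris 352 (2014) 173–177 = arXiv:1310.1900
   (`Morrow2014DeformationalHodge`), **Theorem 1.1** [held: `paper:arxiv-1310.1900`, p. 5
   (statement), p. 7 (§3: `Φ`, `F^p_flat`, Lemma 3.1, Thm. 3.2), p. 8 (end of the proof)] — vendored
   HERE as the named fact `Morrow2014_deformationalHodgeKZero D`. This is also the content of BEK's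
   Rem. 3 (arXiv; Rem. 1.3 of the journal version; Rem. 26 for Chow groups): for `k` algebraic over
   `ℚ`, (i) ⟺ (ii') "`ξ̂|_{X₁} = ξ₁`" WITHOUT the Chow–Künneth hypothesis, "(note that we can use
   integral coefficients here)" — derived below, for rational classes, from Morrow's integral
   statement (`Morrow2014_deformationalHodgeKZero.kZeroRatLiftsFormally_of_hodgeConditionKZeroRat`
   and, conversely, `Morrow2014_deformationalHodgeKZero.mem_flatFil_of_kZeroRatLiftsFormally`).

Printed setting and statement (p. 5): "let `A = K[[t]]`, where `K` is an algebraic extension of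
`ℚ`, and let `X` be a proper, smooth scheme over `A`; let `Y` denote the special fibre, and write
`Y_r = Y ⊗_A A/tʳA` for its `r`th infinitesimal thickening. […] Here `F^p_flat H^{2p}_dR(Y/K)`
denotes the classes of `H^{2p}_dR(Y/K)` whose flat lift to `H^{2p}_dR(X/A)` belongs to
`F^p H^{2p}_dR(X/A)` […]. **Theorem 1.1.** In the situation above, the following are equivalent
for any `z ∈ K₀(Y)`: • `z` lifts to `lim_r K₀(Y_r)`. • The de Rham class
`ch(z) ∈ F^p H^{2p}_dR(Y/K)` belongs to `F^p_flat H^{2p}_dR(Y/K)` for `p = 0, …, dim Y`."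
And p. 7: "`(GM)` breaks into short exact sequences, identifying `Hⁿ_dR(Y/K)` with the so-called
flat/horizontal classes `Hⁿ_dR(X/A)^∇ := ker ∇`" (the isomorphism `Φ`); "Set
`F^p_flat Hⁿ_dR(Y/K) := {x ∈ Hⁿ_dR(Y/K) : Φ⁻¹(x) ∈ F^p Hⁿ_dR(X/A)} ⊆ F^p Hⁿ_dR(Y/K)`."
Printed proof: Goodwillie's theorem (relative `K`-theory ≅ relative negative cyclic homology,
rationally, for the nilpotent thickenings `Y ↪ Y_r`), the pro HKR theorem (Thm. 2.1 / Cor. 2.2),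
finite-dimensionality and Mittag-Leffler, and Lemma 3.1
(`F^p_flat = Im(lim_r ℍⁿ(Y_r, Ω^{≥p}_{Y_r/K}) → F^p Hⁿ_dR(Y/K))`); "Goodwillie's Chern character
[…] coincides with the usual Chern character of de Rham cohomology by [Weibel1993]" (p. 8).

## Rendering (the sibling's currency; integral where Morrow is integral)

* `A = K⟦t⟧` ↦ `PowerSeries k` (`k` is the Lean name of Morrow's `K`), `X` ↦
  `𝒳 : SchemeOver (PowerSeries k)`, `Y` ↦ `DiscScheme.specialFibre 𝒳`, `Y_{r+1}` ↦
  `KTheory.thickening (Ideal.span {PowerSeries.X}) 𝒳 r`, `lim_r K₀(Y_r)` ↦ the INTEGRAL inverse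
  limit `KTheory.LimKZero (Ideal.span {PowerSeries.X}) 𝒳` (whose rationalisation `ℚ ⊗ -` is the
  sibling's `ContinuousKZeroRat`); "`z` lifts to `lim_r K₀(Y_r)`" ↦
  `DiscScheme.KZeroLiftsFormally 𝒳 z` (there is `ẑ` whose bottom component, pulled back along the
  canonical isomorphism `Y → 𝒳 ⊗ A/t = Y₁`, `DiscScheme.specialFibreToTower 𝒳`, is `z`).
* "`K` algebraic over `ℚ`" ↦ `Algebra.IsAlgebraic ℚ k`; "`X` proper, smooth over `A`" ↦
  `IsSmoothProperDiscModel d 𝒳` := smooth of relative dimension `d` and proper, so that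
  "`p = 0, …, dim Y`" is "`p ≤ d`" (Morrow's "smooth" also allows a non-equidimensional `X`, a
  finite disjoint union of equidimensional ones; the vendored statement covers fewer `X`, never
  more). -- TODO(general form): non-equidimensional smooth proper `X/A`.
* `Φ⁻¹` and `F^p Hⁿ_dR(X/A)` ↦ the structure fields `D.phiInv 𝒳 n`, `D.fil 𝒳 n p` of
  `D : DeRhamDiscRealization k`; `F^p_flat Hⁿ_dR(Y/K)` ↦ the definition
  `D.flatFil 𝒳 n p := (D.fil 𝒳 n p).comap (D.phiInv 𝒳 n)` (Morrow's body); `ch(z)` for integral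
  `z ∈ K₀(Y)` ↦ the sibling's `D.chKZero (specialFibre 𝒳) p z`; the second bullet ↦
  `D.FlatHodgeConditionKZero d 𝒳 z := ∀ p ≤ d, ch_p(z) ∈ F^p_flat H^{2p}` (as printed; BEK's
  condition (i) on a rational class, `D.HodgeConditionKZeroRat`, is the same membership in ALL
  degrees, `hodgeConditionKZeroRat_iff_forall_mem_flatFil`).
* THE NAMED FACT `Morrow2014_deformationalHodgeKZero D` (named-fact pattern of the sibling: a
  theorem about THE classical realization, consumed as a hypothesis
  `(h : Morrow2014_deformationalHodgeKZero D)`, never asserted for every `D`).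

## Proved here (no further facts)

* structure-free: algebraizable classes lift (`kZeroLiftsFormally_map_specialFibreι`); the liftable
  classes form the subgroup `liftableClasses 𝒳` (`kZeroLiftsFormally_iff_mem_liftableClasses`,
  `KZeroLiftsFormally.add/neg/sub/nsmul`, `kZeroLiftsFormally_zero`); BEK's rational clause (ii')
  `DiscScheme.KZeroRatLiftsFormally` with (ii') ⇒ (ii)
  (`KZeroRatLiftsFormally.formalVariationalHodgeAlongArc`) and integral ⇒ rational
  (`KZeroLiftsFormally.kZeroRatLiftsFormally_tmul`);
* clearing denominators in `ℚ ⊗_ℤ M` (every element is `N⁻¹ ⊗ m`), whence, under Morrow's fact and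
  `k` algebraic over `ℚ`, BEK Rem. 3 for RATIONAL classes on any smooth proper disc model, with no
  Chow–Künneth / abelian hypothesis: (i) ⇒ (ii')
  (`Morrow2014_deformationalHodgeKZero.kZeroRatLiftsFormally_of_hodgeConditionKZeroRat`), hence
  (i) ⇒ (ii) (`Morrow2014_deformationalHodgeKZero.formalVariationalHodgeAlongArc`), and conversely
  (ii') ⇒ "(i) in the degrees `p ≤ d`" (`Morrow2014_deformationalHodgeKZero.mem_flatFil_of_kZeroRatLiftsFormally`;
  the abstract structure carries no vanishing `H^{2r}_dR = 0` for `r > d`, so (i) in all degrees is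
  not derivable from (ii') here — classically the two agree).

NOT vendored: Thm. 3.2 (the diagram with exact rows — relative groups `K_{-1}(Y_r, Y)` and the
hypercohomology of `Ω^{≥p}_{(Y_r,Y)/K}` are not in the tree's vocabulary), Lemma 3.1 (idem), the
surjectivity remark for `K_n`, `n > 0` (p. 8). No instances, no notation, no `sorry`; ONE named
fact.

## References

* M. Morrow, C. R. Math. Acad. Sci. Paris 352 (2014) 173–177, doi:10.1016/j.crma.2014.01.008 =
  arXiv:1310.1900: Thm. 1.1 (p. 5); §3: `Φ`, `F^p_flat`, Lemma 3.1, Thm. 3.2 (pp. 7–8).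
  [Morrow2014DeformationalHodge]
* S. Bloch, H. Esnault, M. Kerz, Algebraic Geometry 1 (2014) 290–310 = arXiv:1310.1773: Thm. 2,
  Rem. 1, Rem. 3 (p. 3); Rem. 26 (p. 8). [BlochEsnaultKerz2014CharZero]
-/

universe u

open CategoryTheory Limits AlgebraicGeometry TensorProduct
open Literature.AlgebraicGeometry.Motives Literature.AlgebraicGeometry.KTheory
open Literature.AlgebraicGeometry.Crystalline

noncomputable section

namespace Literature.AlgebraicGeometry.HodgeTheory

open DiscScheme

/-! ## Smooth proper disc models -/

/-- `𝒳/k⟦t⟧` is a **smooth proper scheme over the formal disc, of relative dimension `d`** (the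
hypothesis "`X` a proper, smooth scheme over `A = K[[t]]`" of Morrow 2014, Thm. 1.1, with the
relative dimension fixed so that `dim Y = d`; no projectivity, no condition on the fibres, unlike
the sibling's `IsSmoothProjectiveDiscModel`). [cite: Morrow2014DeformationalHodge, §1 (p. 5), before Thm. 1.1] -/
structure IsSmoothProperDiscModel {k : Type u} [Field k] (d : ℕ)
    (𝒳 : SchemeOver (PowerSeries k)) : Prop where
  /-- `𝒳 → Spec k⟦t⟧` is smooth of relative dimension `d`. -/
  smoothOfRelativeDimension : SmoothOfRelativeDimension d 𝒳.hom
  /-- `𝒳 → Spec k⟦t⟧` is proper. -/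
  isProper : IsProper 𝒳.hom

/-- BEK's smooth projective disc models (sibling file) are smooth proper disc models: Morrow's
theorem applies in the setting of BEK Thm. 2, with no Chow–Künneth hypothesis (BEK Rem. 3).
[cite: BlochEsnaultKerz2014CharZero, Rem. 3 (p. 3)] -/
theorem IsSmoothProjectiveDiscModel.isSmoothProperDiscModel {k : Type u} [Field k] {d : ℕ}
    {𝒳 : SchemeOver (PowerSeries k)} (h : IsSmoothProjectiveDiscModel d 𝒳) :
    IsSmoothProperDiscModel d 𝒳 :=
  ⟨h.smoothOfRelativeDimension, h.isProper⟩

/-! ## Formal liftability of `K₀`-classes on the special fibre -/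

namespace DiscScheme

variable {k : Type u} [Field k] (𝒳 : SchemeOver (PowerSeries k))

/-- **Morrow's first bullet** for an integral class `z ∈ K₀(Y)` on the special fibre `Y` of
`𝒳/k⟦t⟧`: "`z` lifts to `lim_r K₀(Y_r)`" — there is a compatible family
`ẑ = (ẑ_r)_r ∈ lim_r K₀(Y_r)` (`KTheory.LimKZero (t) 𝒳`, integral) whose bottom component
`ẑ|_{Y₁} ∈ K₀(𝒳 ⊗ k⟦t⟧/(t))`, pulled back along the canonical isomorphism `Y → 𝒳 ⊗ k⟦t⟧/(t)`
(`specialFibreToTower 𝒳`), is `z`. [cite: Morrow2014DeformationalHodge, Thm. 1.1 (p. 5), first bullet] -/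
def KZeroLiftsFormally (z : KZero (specialFibre 𝒳).left) : Prop :=
  ∃ zhat : LimKZero (Ideal.span {(PowerSeries.X : PowerSeries k)}) 𝒳,
    KZero.map (specialFibreToTower 𝒳)
      (LimKZero.proj (Ideal.span {(PowerSeries.X : PowerSeries k)}) 𝒳 0 zhat) = z

/-- Unfolding lemma. [cite: Morrow2014DeformationalHodge, Thm. 1.1 (p. 5), first bullet] -/
theorem kZeroLiftsFormally_iff (z : KZero (specialFibre 𝒳).left) :
    KZeroLiftsFormally 𝒳 z ↔
      ∃ zhat : LimKZero (Ideal.span {(PowerSeries.X : PowerSeries k)}) 𝒳,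
        KZero.map (specialFibreToTower 𝒳)
          (LimKZero.proj (Ideal.span {(PowerSeries.X : PowerSeries k)}) 𝒳 0 zhat) = z :=
  Iff.rfl

/-- The restriction **`lim_r K₀(Y_r) → K₀(Y)`**, `ẑ ↦ ẑ|_Y` (the left vertical/top arrow of Morrow's
diagram (1.1): projection to the bottom stage followed by the canonical isomorphism
`Y ≅ 𝒳 ⊗ k⟦t⟧/(t)`). [cite: Morrow2014DeformationalHodge, §1 (p. 5), diagram before Thm. 1.1] -/
def limKZeroToSpecialFibre :
    LimKZero (Ideal.span {(PowerSeries.X : PowerSeries k)}) 𝒳 →+ KZero (specialFibre 𝒳).left :=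
  (KZero.map (specialFibreToTower 𝒳)).comp
    (LimKZero.proj (Ideal.span {(PowerSeries.X : PowerSeries k)}) 𝒳 0)

/-- `limKZeroToSpecialFibre ẑ = (Y → Y₁)^* ẑ_0`. [cite: Morrow2014DeformationalHodge, §1 (p. 5)] -/
@[simp]
theorem limKZeroToSpecialFibre_apply
    (zhat : LimKZero (Ideal.span {(PowerSeries.X : PowerSeries k)}) 𝒳) :
    limKZeroToSpecialFibre 𝒳 zhat =
      KZero.map (specialFibreToTower 𝒳)
        (LimKZero.proj (Ideal.span {(PowerSeries.X : PowerSeries k)}) 𝒳 0 zhat) :=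
  rfl

/-- **The liftable classes** `Im(lim_r K₀(Y_r) → K₀(Y)) ⊆ K₀(Y)`, a subgroup (the image of the
top-left arrow of Morrow's diagram (1.1), whose description is Thm. 1.1).
[cite: Morrow2014DeformationalHodge, Thm. 1.1 (p. 5)] -/
def liftableClasses : AddSubgroup (KZero (specialFibre 𝒳).left) :=
  (limKZeroToSpecialFibre 𝒳).range

/-- `z` lifts formally iff it lies in the image of `lim_r K₀(Y_r) → K₀(Y)`.
[cite: Morrow2014DeformationalHodge, Thm. 1.1 (p. 5), first bullet] -/
theorem kZeroLiftsFormally_iff_mem_liftableClasses (z : KZero (specialFibre 𝒳).left) :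
    KZeroLiftsFormally 𝒳 z ↔ z ∈ liftableClasses 𝒳 := by
  simp only [KZeroLiftsFormally, liftableClasses, AddMonoidHom.mem_range,
    limKZeroToSpecialFibre_apply]

/-- `0` lifts. [cite: Morrow2014DeformationalHodge, Thm. 1.1 (p. 5)] -/
theorem kZeroLiftsFormally_zero : KZeroLiftsFormally 𝒳 0 :=
  (kZeroLiftsFormally_iff_mem_liftableClasses 𝒳 0).mpr (AddSubgroup.zero_mem _)

variable {𝒳}

/-- Liftable classes are closed under addition. [cite: Morrow2014DeformationalHodge, Thm. 1.1 (p. 5)] -/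
theorem KZeroLiftsFormally.add {z z' : KZero (specialFibre 𝒳).left} (hz : KZeroLiftsFormally 𝒳 z)
    (hz' : KZeroLiftsFormally 𝒳 z') : KZeroLiftsFormally 𝒳 (z + z') :=
  (kZeroLiftsFormally_iff_mem_liftableClasses 𝒳 _).mpr (AddSubgroup.add_mem _
    ((kZeroLiftsFormally_iff_mem_liftableClasses 𝒳 z).mp hz)
    ((kZeroLiftsFormally_iff_mem_liftableClasses 𝒳 z').mp hz'))

/-- Liftable classes are closed under negation. [cite: Morrow2014DeformationalHodge, Thm. 1.1 (p. 5)] -/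
theorem KZeroLiftsFormally.neg {z : KZero (specialFibre 𝒳).left} (hz : KZeroLiftsFormally 𝒳 z) :
    KZeroLiftsFormally 𝒳 (-z) :=
  (kZeroLiftsFormally_iff_mem_liftableClasses 𝒳 _).mpr (AddSubgroup.neg_mem _
    ((kZeroLiftsFormally_iff_mem_liftableClasses 𝒳 z).mp hz))

/-- Liftable classes are closed under subtraction (differences `[F₊] − [F₋]`).
[cite: Morrow2014DeformationalHodge, Thm. 1.1 (p. 5)] -/
theorem KZeroLiftsFormally.sub {z z' : KZero (specialFibre 𝒳).left} (hz : KZeroLiftsFormally 𝒳 z)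
    (hz' : KZeroLiftsFormally 𝒳 z') : KZeroLiftsFormally 𝒳 (z - z') :=
  (kZeroLiftsFormally_iff_mem_liftableClasses 𝒳 _).mpr (AddSubgroup.sub_mem _
    ((kZeroLiftsFormally_iff_mem_liftableClasses 𝒳 z).mp hz)
    ((kZeroLiftsFormally_iff_mem_liftableClasses 𝒳 z').mp hz'))

/-- Liftable classes are closed under integer multiples. [cite: Morrow2014DeformationalHodge, Thm. 1.1 (p. 5)] -/
theorem KZeroLiftsFormally.zsmul {z : KZero (specialFibre 𝒳).left} (hz : KZeroLiftsFormally 𝒳 z)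
    (n : ℤ) : KZeroLiftsFormally 𝒳 (n • z) :=
  (kZeroLiftsFormally_iff_mem_liftableClasses 𝒳 _).mpr (AddSubgroup.zsmul_mem _
    ((kZeroLiftsFormally_iff_mem_liftableClasses 𝒳 z).mp hz) n)

variable (𝒳)

/-- **Classes that algebraize lift** (the elementary half, no hypothesis on `𝒳` or `k`): for
`ξ ∈ K₀(𝒳)`, the family `ẑ := (ξ|_{Y_r})_r ∈ lim_r K₀(Y_r)` (`LimKZero.restrict`) restricts to
`ξ|_Y` on the special fibre (the composite `K₀(X) → lim_r K₀(Y_r) → K₀(Y)`; BEK §1, (iii) ⇒ (ii')).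
[cite: BlochEsnaultKerz2014CharZero, §1 (p. 3), "(iii) ⇒ (ii) ⇒ (i)"] -/
theorem kZeroLiftsFormally_map_specialFibreι (ξ : KZero 𝒳.left) :
    KZeroLiftsFormally 𝒳 (KZero.map (specialFibreι 𝒳) ξ) := by
  refine ⟨LimKZero.restrict (Ideal.span {(PowerSeries.X : PowerSeries k)}) 𝒳 ξ, ?_⟩
  rw [LimKZero.proj_restrict, ← KZero.map_comp_apply, specialFibreToTower_ι]

/-- **BEK's clause (ii')** for a rational class `ξ₁ ∈ K₀(Y)_ℚ = K₀(X₁)_ℚ`: "there is an element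
`ξ̂ ∈ (lim_n K₀(X_n)) ⊗ ℚ` such that `ξ̂|_{X₁} = ξ₁`" (`ContinuousKZeroRat (t) 𝒳`, restriction
`ContinuousKZeroRat.specialFibre` pulled back along `specialFibreToTower 𝒳`; compare the sibling's
clause (ii) `DeRhamDiscRealization.FormalVariationalHodgeAlongArc`, which only asks
`ch(ξ̂|_{X₁}) = ch(ξ₁)`). [cite: BlochEsnaultKerz2014CharZero, Rem. 3 (p. 3), (ii')] -/
def KZeroRatLiftsFormally (ξ₁ : KZeroRat (specialFibre 𝒳).left) : Prop :=
  ∃ ξ : ContinuousKZeroRat (Ideal.span {(PowerSeries.X : PowerSeries k)}) 𝒳,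
    KZeroRat.map (specialFibreToTower 𝒳)
      (ContinuousKZeroRat.specialFibre (Ideal.span {(PowerSeries.X : PowerSeries k)}) 𝒳 ξ) = ξ₁

/-- Unfolding lemma. [cite: BlochEsnaultKerz2014CharZero, Rem. 3 (p. 3), (ii')] -/
theorem kZeroRatLiftsFormally_iff (ξ₁ : KZeroRat (specialFibre 𝒳).left) :
    KZeroRatLiftsFormally 𝒳 ξ₁ ↔
      ∃ ξ : ContinuousKZeroRat (Ideal.span {(PowerSeries.X : PowerSeries k)}) 𝒳,
        KZeroRat.map (specialFibreToTower 𝒳)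
          (ContinuousKZeroRat.specialFibre
            (Ideal.span {(PowerSeries.X : PowerSeries k)}) 𝒳 ξ) = ξ₁ :=
  Iff.rfl

/-- Rational classes that algebraize satisfy (ii') (BEK §1, (iii) ⇒ (ii'); the sibling's
`exists_formalLift_of_map_specialFibreι`). [cite: BlochEsnaultKerz2014CharZero, §1 (p. 3)] -/
theorem kZeroRatLiftsFormally_map_specialFibreι (ξ : KZeroRat 𝒳.left) :
    KZeroRatLiftsFormally 𝒳 (KZeroRat.map (specialFibreι 𝒳) ξ) :=
  exists_formalLift_of_map_specialFibreι ξ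

variable {𝒳}

/-- **Integral ⇒ rational**: if `z ∈ K₀(Y)` lifts to `ẑ ∈ lim_r K₀(Y_r)`, then `a ⊗ z ∈ K₀(Y)_ℚ`
satisfies (ii') with `ξ̂ = a ⊗ ẑ`. [cite: BlochEsnaultKerz2014CharZero, Rem. 3 (p. 3)] -/
theorem KZeroLiftsFormally.kZeroRatLiftsFormally_tmul {z : KZero (specialFibre 𝒳).left}
    (hz : KZeroLiftsFormally 𝒳 z) (a : ℚ) : KZeroRatLiftsFormally 𝒳 (a ⊗ₜ[ℤ] z) := by
  obtain ⟨zhat, hzhat⟩ := hz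
  refine ⟨a ⊗ₜ[ℤ] zhat, ?_⟩
  rw [ContinuousKZeroRat.proj_tmul, KZeroRat.map_tmul, hzhat]

/-- Integral ⇒ rational on `1 ⊗ z = KZeroRat.ofKZero z`. [cite: BlochEsnaultKerz2014CharZero, Rem. 3 (p. 3)] -/
theorem KZeroLiftsFormally.kZeroRatLiftsFormally_ofKZero {z : KZero (specialFibre 𝒳).left}
    (hz : KZeroLiftsFormally 𝒳 z) : KZeroRatLiftsFormally 𝒳 (KZeroRat.ofKZero z) :=
  hz.kZeroRatLiftsFormally_tmul 1

/-- **(ii') ⇒ (ii)**: a rational class equal to the restriction of a pro-class has, a fortiori,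
the Chern character of that restriction — BEK's clause (ii), the sibling's
`FormalVariationalHodgeAlongArc`, for every de Rham disc realization `D`.
[cite: BlochEsnaultKerz2014CharZero, §1 (p. 3) and Rem. 3] -/
theorem KZeroRatLiftsFormally.formalVariationalHodgeAlongArc {k : Type u} [Field k] [CharZero k]
    (D : DeRhamDiscRealization k) {𝒳 : SchemeOver (PowerSeries k)}
    {ξ₁ : KZeroRat (specialFibre 𝒳).left} (h : KZeroRatLiftsFormally 𝒳 ξ₁) :
    D.FormalVariationalHodgeAlongArc 𝒳 ξ₁ := by
  obtain ⟨ξ, hξ⟩ := h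
  exact ⟨ξ, fun r => by rw [hξ]⟩

end DiscScheme

/-! ## Morrow's flat Hodge filtration and the integral Hodge condition -/

namespace DeRhamDiscRealization

variable {k : Type u} [Field k] [CharZero k] (D : DeRhamDiscRealization k)

/-- **Morrow's flat Hodge filtration** `F^p_flat Hⁿ_dR(Y/K) := {x ∈ Hⁿ_dR(Y/K) : Φ⁻¹(x) ∈
F^p Hⁿ_dR(X/A)}`: the classes on the special fibre whose flat (horizontal) lift to the relative
de Rham cohomology of `𝒳/k⟦t⟧` lies in the Hodge filtration — the preimage of `D.fil 𝒳 n p` under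
Katz's map `D.phiInv 𝒳 n` of the realization. [cite: Morrow2014DeformationalHodge, §3 (p. 7), definition of F^p_flat before Lemma 3.1] -/
def flatFil (𝒳 : SchemeOver (PowerSeries k)) (n : ℕ) (p : ℤ) :
    Submodule k (D.dR₀.obj (specialFibre 𝒳) n) :=
  (D.fil 𝒳 n p).comap (D.phiInv 𝒳 n)

variable {𝒳 : SchemeOver (PowerSeries k)}

/-- `x ∈ F^p_flat ⟺ Φ⁻¹(x) ∈ F^p`. [cite: Morrow2014DeformationalHodge, §3 (p. 7), definition of F^p_flat] -/
theorem mem_flatFil_iff {n : ℕ} {p : ℤ} (x : D.dR₀.obj (specialFibre 𝒳) n) :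
    x ∈ D.flatFil 𝒳 n p ↔ D.phiInv 𝒳 n x ∈ D.fil 𝒳 n p :=
  Iff.rfl

variable (𝒳) in
/-- The flat filtration is decreasing in `p` (as `F^p` is). [cite: Morrow2014DeformationalHodge, §3 (p. 7)] -/
theorem antitone_flatFil (n : ℕ) : Antitone (D.flatFil 𝒳 n) :=
  fun _ _ h => Submodule.comap_mono (D.antitone_fil 𝒳 n h)

variable (𝒳) in
/-- `F^p_flat = Hⁿ_dR(Y/K)` for `p ≤ 0`. [cite: Morrow2014DeformationalHodge, §3 (p. 7)] -/
theorem flatFil_nonpos (n : ℕ) {p : ℤ} (hp : p ≤ 0) : D.flatFil 𝒳 n p = ⊤ := by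
  rw [flatFil, D.fil_nonpos 𝒳 n hp, Submodule.comap_top]

/-- **Morrow's second bullet** for an integral class `z ∈ K₀(Y)` on the special fibre of a disc
model of relative dimension `d`: "the de Rham class `ch(z) ∈ F^p H^{2p}_dR(Y/K)` belongs to
`F^p_flat H^{2p}_dR(Y/K)` for `p = 0, …, dim Y`" (`dim Y = d`).
[cite: Morrow2014DeformationalHodge, Thm. 1.1 (p. 5), second bullet] -/
def FlatHodgeConditionKZero (d : ℕ) (𝒳 : SchemeOver (PowerSeries k))
    (z : KZero (specialFibre 𝒳).left) : Prop :=
  ∀ p : ℕ, p ≤ d → D.chKZero (specialFibre 𝒳) p z ∈ D.flatFil 𝒳 (2 * p) p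

/-- Unfolding lemma. [cite: Morrow2014DeformationalHodge, Thm. 1.1 (p. 5), second bullet] -/
theorem flatHodgeConditionKZero_iff (d : ℕ) (z : KZero (specialFibre 𝒳).left) :
    D.FlatHodgeConditionKZero d 𝒳 z ↔
      ∀ p : ℕ, p ≤ d → D.phiInv 𝒳 (2 * p) (D.chKZero (specialFibre 𝒳) p z) ∈ D.fil 𝒳 (2 * p) p :=
  Iff.rfl

/-- **BEK's condition (i) is the flat condition in all degrees**: for a rational class `ξ₁`,
`D.HodgeConditionKZeroRat 𝒳 ξ₁` (sibling file) says `ch_r(ξ₁) ∈ F^r_flat H^{2r}_dR(Y/K)` for every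
`r` (Morrow: "`F^p_flat` denotes the classes whose flat lift belongs to `F^p`"; BEK (i):
`Φ⁻¹ ∘ ch(ξ₁) ∈ ⊕ H^{2i}^∇ ∩ F^i`). [cite: Morrow2014DeformationalHodge, §1 (p. 5) and Thm. 1.1] -/
theorem hodgeConditionKZeroRat_iff_forall_mem_flatFil (ξ₁ : KZeroRat (specialFibre 𝒳).left) :
    D.HodgeConditionKZeroRat 𝒳 ξ₁ ↔
      ∀ r : ℕ, D.chKZeroRat (specialFibre 𝒳) r ξ₁ ∈ D.flatFil 𝒳 (2 * r) r :=
  Iff.rfl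

/-- The all-degrees flat condition on an integral class implies Morrow's condition in the degrees
`p ≤ d`. [cite: Morrow2014DeformationalHodge, Thm. 1.1 (p. 5), second bullet] -/
theorem flatHodgeConditionKZero_of_forall (d : ℕ) {z : KZero (specialFibre 𝒳).left}
    (hz : ∀ p : ℕ, D.chKZero (specialFibre 𝒳) p z ∈ D.flatFil 𝒳 (2 * p) p) :
    D.FlatHodgeConditionKZero d 𝒳 z :=
  fun p _ => hz p

/-- **Clearing denominators**: `ch_r(N⁻¹ ⊗ z) ∈ F^r_flat ⟺ ch_r(z) ∈ F^r_flat` (`N ≠ 0`; `F^r_flat`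
is a `k`-subspace, `char k = 0`) — BEK Rem. 26: "(note that we can use integral coefficients
here)". [cite: BlochEsnaultKerz2014CharZero, Rem. 26 (p. 8)] -/
theorem chKZeroRat_inv_natCast_tmul_mem_flatFil_iff {N : ℕ} (hN : N ≠ 0)
    (z : KZero (specialFibre 𝒳).left) (r : ℕ) :
    D.chKZeroRat (specialFibre 𝒳) r (((N : ℚ)⁻¹) ⊗ₜ[ℤ] z) ∈ D.flatFil 𝒳 (2 * r) r ↔
      D.chKZero (specialFibre 𝒳) r z ∈ D.flatFil 𝒳 (2 * r) r := by
  have hs : (((N : ℚ)⁻¹ : ℚ) : k) ≠ 0 := by simp [hN]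
  rw [D.chKZeroRat_tmul, mem_flatFil_iff, mem_flatFil_iff, map_smul]
  exact (D.fil 𝒳 (2 * r) r).smul_mem_iff hs

end DeRhamDiscRealization

/-! ## Clearing denominators in `ℚ ⊗_ℤ M` -/

section ClearDenominators

/-- Every element of `ℚ ⊗_ℤ M` is of the form `N⁻¹ ⊗ m` with `N ≥ 1` (common denominator;
`ℚ ⊗_ℤ M = M[1/ℤ∖0]`). [folklore] -/
private theorem exists_inv_natCast_tmul_eq {M : Type*} [AddCommGroup M] (ξ : ℚ ⊗[ℤ] M) :
    ∃ N : ℕ, N ≠ 0 ∧ ∃ m : M, ((N : ℚ)⁻¹) ⊗ₜ[ℤ] m = ξ := by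
  induction ξ using TensorProduct.induction_on with
  | zero => exact ⟨1, one_ne_zero, 0, by rw [tmul_zero]⟩
  | tmul q m =>
    refine ⟨q.den, q.den_ne_zero, q.num • m, ?_⟩
    rw [← smul_tmul, zsmul_eq_mul, ← div_eq_mul_inv, Rat.num_div_den]
  | add x y hx hy =>
    obtain ⟨N, hN, m, rfl⟩ := hx
    obtain ⟨N', hN', m', rfl⟩ := hy
    have hNq : (N : ℚ) ≠ 0 := Nat.cast_ne_zero.mpr hN
    have hN'q : (N' : ℚ) ≠ 0 := Nat.cast_ne_zero.mpr hN'
    have h1 : ((N' : ℤ) • (((N * N' : ℕ) : ℚ)⁻¹)) = (N : ℚ)⁻¹ := by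
      rw [zsmul_eq_mul, Int.cast_natCast, Nat.cast_mul, mul_inv, mul_left_comm,
        mul_inv_cancel₀ hN'q, mul_one]
    have h2 : ((N : ℤ) • (((N * N' : ℕ) : ℚ)⁻¹)) = (N' : ℚ)⁻¹ := by
      rw [zsmul_eq_mul, Int.cast_natCast, Nat.cast_mul, mul_inv, ← mul_assoc,
        mul_inv_cancel₀ hNq, one_mul]
    refine ⟨N * N', mul_ne_zero hN hN', (N' : ℤ) • m + (N : ℤ) • m', ?_⟩
    rw [tmul_add, ← smul_tmul, ← smul_tmul, h1, h2]

end ClearDenominators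

/-! ## Theorem 1.1 as a predicate of the realization -/

section Morrow

variable {k : Type u} [Field k] [CharZero k]

/-- **Morrow 2014, Theorem 1.1** (Morrow's deformational Hodge THEOREM: formal lifting of INTEGRAL
`K₀`-classes over `K⟦t⟧` is governed by the Hodge filtration — a proved result, printed with proof
in the cited note), as a property of the de Rham disc realization `D` (named-fact pattern of the
sibling `BlochEsnaultKerzFormalLifting`: a theorem about THE classical realization — algebraic
de Rham cohomology, Gauss–Manin connection, Grothendieck–Goodwillie Chern character — consumed as a
hypothesis `(h : Morrow2014_deformationalHodgeKZero D)`, not asserted for every `D`): if `k` is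
algebraic over `ℚ`, then for every smooth proper `𝒳/k⟦t⟧` of relative
dimension `d` (`IsSmoothProperDiscModel d 𝒳`; special fibre `Y`, thickenings
`Y_{r+1} = 𝒳 ⊗ k⟦t⟧/(t^{r+1})`) and every `z ∈ K₀(Y)`, the following are equivalent:
• `z` lifts to `lim_r K₀(Y_r)` (`KZeroLiftsFormally 𝒳 z`);
• `ch_p(z) ∈ F^p_flat H^{2p}_dR(Y/K)` for `p = 0, …, d = dim Y` (`D.FlatHodgeConditionKZero d 𝒳 z`:
the flat lift `Φ⁻¹(ch_p z)` lies in `F^p H^{2p}_dR(X/A)`). No projectivity and no Chow–Künneth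
hypothesis; also BEK 2014 (char. 0) Rem. 3 / Rem. 26. Printed proof: Goodwillie's theorem + the pro
HKR theorem (Thm. 2.1, Cor. 2.2) + Mittag-Leffler + Lemma 3.1.
[cite: Morrow2014DeformationalHodge, Thm. 1.1 (p. 5); proof §3, Thm. 3.2 (pp. 7–8)] -/
def Morrow2014_deformationalHodgeKZero (D : DeRhamDiscRealization k) : Prop :=
  Algebra.IsAlgebraic ℚ k →
    ∀ ⦃d : ℕ⦄ ⦃𝒳 : SchemeOver (PowerSeries k)⦄, IsSmoothProperDiscModel d 𝒳 →
      ∀ z : KZero (specialFibre 𝒳).left,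
        KZeroLiftsFormally 𝒳 z ↔ D.FlatHodgeConditionKZero d 𝒳 z

variable {D : DeRhamDiscRealization k} {d : ℕ} {𝒳 : SchemeOver (PowerSeries k)}

namespace Morrow2014_deformationalHodgeKZero

/-- Thm. 1.1, unfolded at a disc model. [cite: Morrow2014DeformationalHodge, Thm. 1.1 (p. 5)] -/
theorem kZeroLiftsFormally_iff (h : Morrow2014_deformationalHodgeKZero D)
    (hk : Algebra.IsAlgebraic ℚ k) (h𝒳 : IsSmoothProperDiscModel d 𝒳)
    (z : KZero (specialFibre 𝒳).left) :
    KZeroLiftsFormally 𝒳 z ↔ D.FlatHodgeConditionKZero d 𝒳 z :=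
  h hk h𝒳 z

/-- **Thm. 1.1, direction "Hodge ⇒ lift"** (the one deformation arguments consume): an integral
class whose Chern character stays in the Hodge filtration along the disc lifts to
`lim_r K₀(Y_r)`. [cite: Morrow2014DeformationalHodge, Thm. 1.1 (p. 5)] -/
theorem kZeroLiftsFormally (h : Morrow2014_deformationalHodgeKZero D)
    (hk : Algebra.IsAlgebraic ℚ k) (h𝒳 : IsSmoothProperDiscModel d 𝒳)
    {z : KZero (specialFibre 𝒳).left} (hz : D.FlatHodgeConditionKZero d 𝒳 z) :
    KZeroLiftsFormally 𝒳 z :=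
  (h hk h𝒳 z).mpr hz

/-- **Thm. 1.1, direction "lift ⇒ Hodge"**: a formally liftable integral class has its Chern
character in `F^p_flat` for `p ≤ dim Y`. [cite: Morrow2014DeformationalHodge, Thm. 1.1 (p. 5)] -/
theorem flatHodgeConditionKZero (h : Morrow2014_deformationalHodgeKZero D)
    (hk : Algebra.IsAlgebraic ℚ k) (h𝒳 : IsSmoothProperDiscModel d 𝒳)
    {z : KZero (specialFibre 𝒳).left} (hz : KZeroLiftsFormally 𝒳 z) :
    D.FlatHodgeConditionKZero d 𝒳 z :=
  (h hk h𝒳 z).mp hz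

/-- Thm. 1.1 with the Hodge condition given in all degrees (as in BEK (i)).
[cite: Morrow2014DeformationalHodge, Thm. 1.1 (p. 5)] -/
theorem kZeroLiftsFormally_of_forall (h : Morrow2014_deformationalHodgeKZero D)
    (hk : Algebra.IsAlgebraic ℚ k) (h𝒳 : IsSmoothProperDiscModel d 𝒳)
    {z : KZero (specialFibre 𝒳).left}
    (hz : ∀ p : ℕ, D.chKZero (specialFibre 𝒳) p z ∈ D.flatFil 𝒳 (2 * p) p) :
    KZeroLiftsFormally 𝒳 z :=
  h.kZeroLiftsFormally hk h𝒳 (D.flatHodgeConditionKZero_of_forall d hz)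

/-- The liftable subgroup `Im(lim_r K₀(Y_r) → K₀(Y))` is cut out by the flat Hodge condition
(the cocartesian left square of Morrow's diagram (1.1), elementwise).
[cite: Morrow2014DeformationalHodge, §1 (p. 5), "the left square is cocartesian", and Thm. 1.1] -/
theorem mem_liftableClasses_iff (h : Morrow2014_deformationalHodgeKZero D)
    (hk : Algebra.IsAlgebraic ℚ k) (h𝒳 : IsSmoothProperDiscModel d 𝒳)
    (z : KZero (specialFibre 𝒳).left) :
    z ∈ liftableClasses 𝒳 ↔ D.FlatHodgeConditionKZero d 𝒳 z := by
  rw [← kZeroLiftsFormally_iff_mem_liftableClasses]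
  exact h hk h𝒳 z

/-- **BEK Rem. 3, (i) ⇒ (ii'), from Morrow's theorem** (rational classes, `k` algebraic over `ℚ`,
`𝒳/k⟦t⟧` smooth proper — no Chow–Künneth / abelian hypothesis): if `ξ₁ ∈ K₀(Y)_ℚ` satisfies the
sibling's Hodge condition (i) `D.HodgeConditionKZeroRat 𝒳 ξ₁`, then there is
`ξ̂ ∈ (lim_r K₀(Y_r)) ⊗ ℚ` with `ξ̂|_Y = ξ₁`. Proof: write `ξ₁ = N⁻¹ ⊗ z` with `z` integral; (i) for
`ξ₁` is the flat condition for `z` in all degrees (`F_flat` is a `k`-subspace); lift `z` by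
Thm. 1.1 and take `ξ̂ = N⁻¹ ⊗ ẑ`. [cite: BlochEsnaultKerz2014CharZero, Rem. 3 (p. 3)] [cite: Morrow2014DeformationalHodge, Thm. 1.1 (p. 5)] -/
theorem kZeroRatLiftsFormally_of_hodgeConditionKZeroRat (h : Morrow2014_deformationalHodgeKZero D)
    (hk : Algebra.IsAlgebraic ℚ k) (h𝒳 : IsSmoothProperDiscModel d 𝒳)
    {ξ₁ : KZeroRat (specialFibre 𝒳).left} (hξ : D.HodgeConditionKZeroRat 𝒳 ξ₁) :
    KZeroRatLiftsFormally 𝒳 ξ₁ := by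
  obtain ⟨N, hN, z, rfl⟩ := exists_inv_natCast_tmul_eq ξ₁
  have hz : ∀ p : ℕ, D.chKZero (specialFibre 𝒳) p z ∈ D.flatFil 𝒳 (2 * p) p := fun p =>
    (D.chKZeroRat_inv_natCast_tmul_mem_flatFil_iff hN z p).mp
      ((D.hodgeConditionKZeroRat_iff_forall_mem_flatFil _).mp hξ p)
  exact (h.kZeroLiftsFormally_of_forall hk h𝒳 hz).kZeroRatLiftsFormally_tmul _

/-- **BEK Rem. 3, (i) ⇒ (ii), from Morrow's theorem**: under the same hypotheses, (i) implies the
sibling's clause (ii) `FormalVariationalHodgeAlongArc` (`ch(ξ̂|_Y) = ch(ξ₁)`), for smooth proper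
disc models with no abelian / Chow–Künneth hypothesis (compare the sibling's
`BlochEsnaultKerzFormalLifting.formalVariationalHodgeAlongArc`, which needs an abelian generic fibre
but allows any `k` of characteristic `0`). [cite: BlochEsnaultKerz2014CharZero, Rem. 3 (p. 3)] [cite: Morrow2014DeformationalHodge, Thm. 1.1 (p. 5)] -/
theorem formalVariationalHodgeAlongArc (h : Morrow2014_deformationalHodgeKZero D)
    (hk : Algebra.IsAlgebraic ℚ k) (h𝒳 : IsSmoothProperDiscModel d 𝒳)
    {ξ₁ : KZeroRat (specialFibre 𝒳).left} (hξ : D.HodgeConditionKZeroRat 𝒳 ξ₁) :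
    D.FormalVariationalHodgeAlongArc 𝒳 ξ₁ :=
  (h.kZeroRatLiftsFormally_of_hodgeConditionKZeroRat hk h𝒳 hξ).formalVariationalHodgeAlongArc D

/-- **BEK Rem. 3, (ii') ⇒ (i) in the degrees `r ≤ dim Y`, from Morrow's theorem**: if the rational
class `ξ₁` is the restriction of a pro-class `ξ̂ ∈ (lim_r K₀(Y_r)) ⊗ ℚ`, then
`ch_r(ξ₁) ∈ F^r_flat H^{2r}_dR(Y/K)` for every `r ≤ d` (write `ξ̂ = N⁻¹ ⊗ ŵ`; then `ξ₁ = N⁻¹ ⊗ ŵ|_Y`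
and `ŵ|_Y` lifts). Classically `H^{2r}_dR(Y/K) = 0` for `r > d`, so this is all of (i); the abstract
structure `D` carries no such vanishing, whence the bound.
[cite: BlochEsnaultKerz2014CharZero, Rem. 3 (p. 3)] [cite: Morrow2014DeformationalHodge, Thm. 1.1 (p. 5)] -/
theorem mem_flatFil_of_kZeroRatLiftsFormally (h : Morrow2014_deformationalHodgeKZero D)
    (hk : Algebra.IsAlgebraic ℚ k) (h𝒳 : IsSmoothProperDiscModel d 𝒳)
    {ξ₁ : KZeroRat (specialFibre 𝒳).left} (hξ : KZeroRatLiftsFormally 𝒳 ξ₁) {r : ℕ}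
    (hr : r ≤ d) :
    D.chKZeroRat (specialFibre 𝒳) r ξ₁ ∈ D.flatFil 𝒳 (2 * r) r := by
  obtain ⟨ξ, hξ⟩ := hξ
  obtain ⟨N, hN, w, rfl⟩ := exists_inv_natCast_tmul_eq ξ
  rw [ContinuousKZeroRat.proj_tmul, KZeroRat.map_tmul] at hξ
  rw [← hξ, D.chKZeroRat_inv_natCast_tmul_mem_flatFil_iff hN]
  exact h.flatHodgeConditionKZero hk h𝒳 ⟨w, rfl⟩ r hr

/-- In BEK's own setting (`𝒳/k⟦t⟧` smooth PROJECTIVE, sibling's `IsSmoothProjectiveDiscModel`),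
`k` algebraic over `ℚ`: (i) ⇒ (ii') with no Chow–Künneth hypothesis (BEK Rem. 3 as printed).
[cite: BlochEsnaultKerz2014CharZero, Rem. 3 (p. 3)] [cite: Morrow2014DeformationalHodge, Thm. 1.1 (p. 5)] -/
theorem kZeroRatLiftsFormally_of_hodgeConditionKZeroRat_of_isSmoothProjectiveDiscModel
    (h : Morrow2014_deformationalHodgeKZero D) (hk : Algebra.IsAlgebraic ℚ k)
    (h𝒳 : IsSmoothProjectiveDiscModel d 𝒳) {ξ₁ : KZeroRat (specialFibre 𝒳).left}
    (hξ : D.HodgeConditionKZeroRat 𝒳 ξ₁) : KZeroRatLiftsFormally 𝒳 ξ₁ :=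
  h.kZeroRatLiftsFormally_of_hodgeConditionKZeroRat hk h𝒳.isSmoothProperDiscModel hξ

end Morrow2014_deformationalHodgeKZero

end Morrow

end Literature.AlgebraicGeometry.HodgeTheory

end
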